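import Summits.Ventures.CertifiedManyBodySolver.Observables.EtaPairingExclusionBelowQuarterFilling
import Literature.MathematicalPhysics.QuantumLattice.InfVolFermionStateParticleHoleHubbardEnergy
import Literature.MathematicalPhysics.QuantumLattice.HubbardNNNHoppingEnergyDensityParticleHole
import Literature.MathematicalPhysics.QuantumLattice.HubbardNNRepulsionInteraction
import Literature.MathematicalPhysics.QuantumLattice.FermionOperatorsEtaSu2Proofs
import Literature.MathematicalPhysics.QuantumLattice.HubbardHubbardModelEtaODLROProofs
import Literature.MathematicalPhysics.QuantumLattice.FermionOperatorsProofs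
import Literature.MathematicalPhysics.QuantumLattice.TranslationInvariantFermionStatesAreEven
import HarnessLib

/-!
# η-PAIRING ODLRO IS EXCLUDED ABOVE THREE-HALVES FILLING AT EVERY REPULSION — the particle–hole mirror
# of `EtaPairingExclusionBelowQuarterFilling`, transported at the STATE level

HONEST FRAMING: exclusions in Yang's staggered `s`-wave (η) pair channel, where nobody expects order; NOTHING about `d`-wave
pairing or the uniform on-site channel; CTL/dictionary class; not a superconductivity verdict; no phase sentence. Crew
hubbard-obs (D-0042), seat hubbard-obs-p1 (`prover-hubbard-obs-p1-g15-0`); part 3 of the g15 η files. ZERO compute; no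
definition; no `sorry`; no claim node.

WHY A SEPARATE ARGUMENT IS NEEDED. The lever behind parts 1–2 (`HubbardEtaPairingNoLROBelowHalfCoupling`: Bratteli–Robinson
stability tested on `η_Λ`, Yang's `[H − μN, η†_Λ] = (U − 2μ)η†_Λ − ∂`) wants `2μ < U`, i.e. a supporting chemical potential
BELOW half coupling — available only for densities `n < 1`. Above half filling we do not re-run the stability argument on
`η†_Λ`; instead we TRANSPORT the below-quarter-filling theorem through Lieb's staggered particle–hole automorphism
`α : c_{xσ} ↦ ε_x c†_{xσ}` at the level of infinite-volume states (tree: `InfVolFermionState.particleHole`,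
`InfVolFermionStateParticleHole[HubbardEnergy]`):
* §1 operator identities on every region `Λ`: `α_Λ(η†_Λ) = −η_Λ`, `α_Λ(η_Λ) = −η†_Λ`, hence
  `α_Λ(η†_Λ η_Λ) = η_Λ η†_Λ = η†_Λ η_Λ − (N_Λ − |Λ|)` (Yang–Zhang `[η†, η] = 2η^z = N − |Λ|`);
* §2 for a translation-invariant `ω` of density `n`: `Re (ω ∘ α)(η†_Λ η_Λ) = Re ω(η†_Λ η_Λ) + (1 − n)|Λ|`;
* §3 if `ω` is a translation-invariant ground state of density `n` (`e(ω) = e(U, n)`), then `ω ∘ α` is one of density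
  `2 − n` (`e(ω ∘ α) = e(ω) + U(1 − n) = e(U, 2 − n)` by the state-level and the function-level particle–hole identities
  `IsTranslationInvariant.meanEnergy_hubbardTTPrime_zero_particleHole`, `energyDensityTT'_particleHole`);
* §4 **THE MIRROR THEOREM**: for EVERY `U > 0` and EVERY density `3/2 < n < 2`, every translation-invariant ground state
  `ω` of density `n` has NO η-pairing ODLRO — `M⁻⁴ Re ω(η†_{Λ_M} η_{Λ_M}) → 0` — with the explicit local bound
  `Re ω(η†_Λ η_Λ) ≤ 64(|Λ'| − |Λ|)²/(U(2n − 3)/(2(n − 1)))² + (n − 1)|Λ|` (`Λ' ⊇ thicken Λ 1`; the `O(|Λ|)` term is the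
  particle–hole commutator `N_Λ − |Λ|`, invisible at the ODLRO scale `|Λ|²`), and at `n = 3/2` for every `U ≥ 0` with the
  `U`-uniform constant `1.2251963` of part 1.
Together with parts 1–2: **η-pairing ODLRO is absent in every translation-invariant ground state of the `t' = 0`
square-lattice Hubbard model at every `U > 0` whenever `|n − 1| > 1/2`, at `|n − 1| = 1/2` for every `U ≥ 0`, and for
`|n − 1| < 1/2` inside the weak-coupling windows of part 2 (mirrored by `n ↦ 2 − n`).**

References: E. H. Lieb, PRL 62 (1989) 1201, proof of Thm 2 (the staggered particle–hole map) [LiebPRL1989]; C. N. Yang,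
S. C. Zhang, Mod. Phys. Lett. B 4 (1990) 759, Thm 1 (`[η†, η] = 2η^z`) [YangZhang1990]; C. N. Yang, PRL 63 (1989) 2144
[Yang1989]; O. Bratteli, D. W. Robinson, OAQSM 2 (1997) Prop. 5.3.19 [BratteliRobinsonII1997]; H. Tasaki, *Physics and
Mathematics of Quantum Many-Body Systems* (2020) §9.3.3 [Tasaki2020].
-/

noncomputable section

namespace Summit.Ventures.CertifiedManyBodySolver.Observables

open Matrix Finset Filter Literature.MathematicalPhysics.QuantumLattice Literature.Probability.LatticeModels
open Literature.MathematicalPhysics.QuantumLattice.HubbardWave0 ThermodynamicLimit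
open scoped ComplexOrder Topology

/-! ### §1 The staggered particle–hole automorphism on Yang's region operators -/

/-- `(ε : ℂ)·(ε : ℂ) = 1` for a sign `ε : ℤˣ`. [folklore] -/
private theorem units_cast_mul_self (u : ℤˣ) : (((u : ℤ) : ℂ)) * (((u : ℤ) : ℂ)) = 1 := by
  rw [← Int.cast_mul, Int.units_coe_mul_self, Int.cast_one]

/-- **`α_Λ(η†_Λ) = −η_Λ`**: the staggered particle–hole automorphism maps Yang's raising operator of a region to
MINUS its lowering operator (`α(c†_{x↑}c†_{x↓}) = ε_x² c_{x↑}c_{x↓} = −c_{x↓}c_{x↑}`). [cite: LiebPRL1989, proof of Theorem 2]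
[cite: Yang1989, eq. (4)] -/
theorem phAut_etaRaise (Λ : Finset (Site 2)) :
    phAut Λ (etaRaise (fun w : PolySite Λ => siteStagger (ofLex w.1))) =
      -etaLower (fun w : PolySite Λ => siteStagger (ofLex w.1)) := by
  rw [etaRaise, map_sum, etaLower_eq_sum_holds, ← Finset.sum_neg_distrib]
  refine Finset.sum_congr rfl fun w _ => ?_
  rw [map_smul, map_mul, phAut, particleHoleAut_creation, particleHoleAut_creation, phSign_orb, phSign_orb,
    Matrix.smul_mul, Matrix.mul_smul, smul_smul, smul_smul, units_cast_mul_self, one_mul,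
    eq_neg_of_add_eq_zero_left (annihilation_anticommute_holds (orb w 0) (orb w 1)), smul_neg]

/-- **`α_Λ(η_Λ) = −η†_Λ`** (`α_Λ` is a `*`-map and `η_Λ = (η†_Λ)ᴴ`). [cite: LiebPRL1989, proof of Theorem 2] [cite: Yang1989, eq. (4)] -/
theorem phAut_etaLower (Λ : Finset (Site 2)) :
    phAut Λ (etaLower (fun w : PolySite Λ => siteStagger (ofLex w.1))) =
      -etaRaise (fun w : PolySite Λ => siteStagger (ofLex w.1)) := by
  rw [etaLower, phAut_conjTranspose, phAut_etaRaise, conjTranspose_neg, etaLower, conjTranspose_conjTranspose]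

/-- **`α_Λ(η†_Λ η_Λ) = η†_Λ η_Λ − (N_Λ − |Λ|)`** (`= η_Λ η†_Λ`; Yang–Zhang `[η†, η] = 2η^z = N − |Λ|`).
[cite: YangZhang1990, Theorem 1] [cite: LiebPRL1989, proof of Theorem 2] -/
theorem phAut_etaRaise_mul_etaLower (Λ : Finset (Site 2)) :
    phAut Λ (etaRaise (fun w : PolySite Λ => siteStagger (ofLex w.1)) *
        etaLower (fun w : PolySite Λ => siteStagger (ofLex w.1))) =
      etaRaise (fun w : PolySite Λ => siteStagger (ofLex w.1)) *
          etaLower (fun w : PolySite Λ => siteStagger (ofLex w.1)) -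
        (Literature.MathematicalPhysics.QuantumLattice.totalNumber - (Fintype.card (PolySite Λ) : ℂ) • (1 : FermionOp Λ)) := by
  rw [map_mul, phAut_etaRaise, phAut_etaLower, neg_mul_neg, ← two_smul_etaZ, ← etaRaise_commutator_etaLower]
  abel

/-! ### §2 Expectations: `Re (ω ∘ α)(η†_Λ η_Λ) = Re ω(η†_Λ η_Λ) + (1 − n)|Λ|` -/

/-- `Re ω_Λ(N_Λ) = |Λ|·ρ` for a translation-invariant state (`N_Λ = Σ_{x∈Λ,σ} n_{xσ}`). [cite: ArakiMoriya2003, §4.1] -/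
theorem re_expect_totalNumber_of_isTranslationInvariant {ω : InfVolFermionState 2} (hω : ω.IsTranslationInvariant)
    (Λ : Finset (Site 2)) :
    (ω.expect Λ (Literature.MathematicalPhysics.QuantumLattice.totalNumber : FermionOp Λ)).re = (#Λ : ℝ) * ω.density := by
  rw [Literature.MathematicalPhysics.QuantumLattice.totalNumber, map_sum, Complex.re_sum]
  have hterm : ∀ w : PolySite Λ, (ω.expect Λ (∑ σ : Fin 2, numberOp w σ)).re = ω.density := fun w => by
    rw [Fin.sum_univ_two, ← PolySite.pt_ofLex w]
    exact (ω.re_expect_density_eq_densityAt (PolySite.ofLex_mem w)).trans (hω.densityAt_eq_density _)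
  simp_rw [hterm]
  rw [Finset.sum_const, Finset.card_univ, nsmul_eq_mul]
  rw [card_polySite]

/-- **`Re (ω ∘ α)(η†_Λ η_Λ) = Re ω(η†_Λ η_Λ) + (1 − ρ)|Λ|`** for translation-invariant `ω`.
[cite: LiebPRL1989, proof of Theorem 2] [cite: YangZhang1990, Theorem 1] -/
theorem re_particleHole_expect_etaRaise_mul_etaLower {ω : InfVolFermionState 2} (hω : ω.IsTranslationInvariant)
    (Λ : Finset (Site 2)) :
    (ω.particleHole.expect Λ (etaRaise (fun w : PolySite Λ => siteStagger (ofLex w.1)) *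
        etaLower (fun w : PolySite Λ => siteStagger (ofLex w.1)))).re =
      (ω.expect Λ (etaRaise (fun w : PolySite Λ => siteStagger (ofLex w.1)) *
        etaLower (fun w : PolySite Λ => siteStagger (ofLex w.1)))).re + (1 - ω.density) * #Λ := by
  rw [InfVolFermionState.particleHole_expect, phAut_etaRaise_mul_etaLower, map_sub, map_sub, map_smul, ω.expect_one,
    smul_eq_mul, mul_one, Complex.sub_re, Complex.sub_re, re_expect_totalNumber_of_isTranslationInvariant hω,
    Complex.natCast_re, card_polySite]
  ring

/-! ### §3 The ground-state class is particle–hole symmetric about half filling -/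

/-- **The particle–hole transform of a translation-invariant ground state of density `n` is one of density `2 − n`**
(`t' = 0`, `U ≥ 0`, `0 < n < 2`): it is translation invariant, has density `2 − n`, and attains `e(1,0,U,2 − n)`.
[cite: LiebPRL1989, proof of Theorem 2] [cite: LiebWuPhysicaA2003, §1 eq. (3)] -/
theorem groundStateClass_particleHole {U n : ℝ} (hU : 0 ≤ U) (hn0 : 0 < n) (hn2 : n < 2)
    {ω : InfVolFermionState 2} (hω : ω.IsTranslationInvariant) (hρ : ω.density = n)
    (hme : ω.meanEnergy (hubbardTTPrimeFermionInteraction 1 0 U) 1 = energyDensityTT' 1 0 U n) :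
    ω.particleHole.IsTranslationInvariant ∧ ω.particleHole.density = 2 - n ∧
      ω.particleHole.meanEnergy (hubbardTTPrimeFermionInteraction 1 0 U) 1 = energyDensityTT' 1 0 U (2 - n) := by
  refine ⟨hω.particleHole (hω.isEven two_pos), by rw [InfVolFermionState.density_particleHole, hρ], ?_⟩
  rw [hω.meanEnergy_hubbardTTPrime_zero_particleHole, hme, hρ]
  have h := energyDensityTT'_particleHole 1 0 hU hn0 hn2
  rw [neg_zero] at h
  linarith

/-! ### §4 THE MIRROR THEOREM: every `U > 0`, every `3/2 < n < 2`; `n = 3/2` for every `U ≥ 0` -/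

/-- **η-PAIRING ODLRO IS ABSENT ABOVE THREE-HALVES FILLING AT EVERY REPULSION.** For the `t' = 0` square-lattice Hubbard
model with ANY `U > 0` and ANY density `3/2 < n < 2`, every translation-invariant ground state `ω` of density `n` has
`M⁻⁴ Re ω(η†_{Λ_M} η_{Λ_M}) → 0` and, for every finite `Λ` and `Λ' ⊇ thicken Λ 1`,
`Re ω(η†_Λ η_Λ) ≤ 64(|Λ'| − |Λ|)²/(U(2n − 3)/(2(n − 1)))² + (n − 1)|Λ|`. [cite: Yang1989, eqs. (6)–(8)]
[cite: BratteliRobinsonII1997, Prop. 5.3.19] [cite: LiebPRL1989, proof of Theorem 2] -/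
theorem etaPairing_exclusion_of_gt_threeHalvesFilling {U n : ℝ} (hU : 0 < U) (hn : 3 / 2 < n) (hn2 : n < 2)
    {ω : InfVolFermionState 2} (hω : ω.IsTranslationInvariant) (hρ : ω.density = n)
    (hme : ω.meanEnergy (hubbardTTPrimeFermionInteraction 1 0 U) 1 = energyDensityTT' 1 0 U n) :
    Tendsto (fun M : ℕ =>
        (ω.expect (halfOpenBox 2 M) (etaRaise (fun w : PolySite (halfOpenBox 2 M) => siteStagger (ofLex w.1)) *
          etaLower (fun w : PolySite (halfOpenBox 2 M) => siteStagger (ofLex w.1)))).re / (M : ℝ) ^ 4)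
        atTop (𝓝 0) ∧
      ∀ {Λ Λ' : Finset (Site 2)}, Λ ⊆ Λ' → thicken Λ 1 ⊆ Λ' →
        (ω.expect Λ (etaRaise (fun w : PolySite Λ => siteStagger (ofLex w.1)) *
            etaLower (fun w : PolySite Λ => siteStagger (ofLex w.1)))).re ≤
          64 * ((#Λ' : ℝ) - #Λ) ^ 2 / (U * (2 * n - 3) / (2 * (n - 1))) ^ 2 + (n - 1) * #Λ := by
  obtain ⟨hω', hρ', hme'⟩ := groundStateClass_particleHole hU.le (by linarith) hn2 hω hρ hme
  have hA := etaPairing_exclusion_of_lt_quarterFilling hU (n := 2 - n) (by linarith) (by linarith) hω' hρ' hme'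
  -- read `ω` as the particle–hole transform of `ω ∘ α`
  have hkey : ∀ Λ : Finset (Site 2),
      (ω.expect Λ (etaRaise (fun w : PolySite Λ => siteStagger (ofLex w.1)) *
          etaLower (fun w : PolySite Λ => siteStagger (ofLex w.1)))).re =
        (ω.particleHole.expect Λ (etaRaise (fun w : PolySite Λ => siteStagger (ofLex w.1)) *
          etaLower (fun w : PolySite Λ => siteStagger (ofLex w.1)))).re + (n - 1) * #Λ := fun Λ => by
    have h := re_particleHole_expect_etaRaise_mul_etaLower hω' Λ
    rw [InfVolFermionState.particleHole_particleHole, hρ'] at h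
    rw [h]
    ring
  have hmargin : U * (1 - 2 * (2 - n)) / (2 * (1 - (2 - n))) = U * (2 * n - 3) / (2 * (n - 1)) := by
    congr 1 <;> ring
  refine ⟨?_, fun {Λ Λ'} hΛ h8 => ?_⟩
  · have hsplit : (fun M : ℕ =>
        (ω.expect (halfOpenBox 2 M) (etaRaise (fun w : PolySite (halfOpenBox 2 M) => siteStagger (ofLex w.1)) *
          etaLower (fun w : PolySite (halfOpenBox 2 M) => siteStagger (ofLex w.1)))).re / (M : ℝ) ^ 4) =
        fun M : ℕ => (ω.particleHole.expect (halfOpenBox 2 M)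
          (etaRaise (fun w : PolySite (halfOpenBox 2 M) => siteStagger (ofLex w.1)) *
            etaLower (fun w : PolySite (halfOpenBox 2 M) => siteStagger (ofLex w.1)))).re / (M : ℝ) ^ 4 +
          (n - 1) * ((M : ℝ) ^ 2 / (M : ℝ) ^ 4) := by
      funext M
      rw [hkey, card_halfOpenBox]
      push_cast
      ring
    rw [hsplit, show (0 : ℝ) = 0 + (n - 1) * 0 by ring]
    refine hA.1.add (Tendsto.const_mul _ ?_)
    have h2 : (fun M : ℕ => (M : ℝ) ^ 2 / (M : ℝ) ^ 4) =ᶠ[atTop] fun M : ℕ => ((M : ℝ) ^ 2)⁻¹ := by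
      filter_upwards [eventually_gt_atTop 0] with M hM
      have hM' : (0 : ℝ) < M := by exact_mod_cast hM
      field_simp
    rw [tendsto_congr' h2]
    exact tendsto_inv_atTop_zero.comp ((tendsto_pow_atTop two_ne_zero).comp tendsto_natCast_atTop_atTop)
  · rw [hkey, ← hmargin]
    have hB := hA.2 hΛ h8
    linarith

/-- **At three-halves filling `(U, 3/2, 0)`, every `U ≥ 0`**: `M⁻⁴ Re ω(η†η) → 0` and
`Re ω(η†_Λ η_Λ) ≤ 64(|Λ'| − |Λ|)²/1.2251963² + |Λ|/2` for every translation-invariant ground state of density `3/2`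
(mirror of `etaPairing_exclusion_quarterFilling`). [cite: Yang1989, eqs. (6)–(8)] [cite: BratteliRobinsonII1997, Prop. 5.3.19]
[cite: LiebPRL1989, proof of Theorem 2] -/
theorem etaPairing_exclusion_threeHalvesFilling {U : ℝ} (hU : 0 ≤ U)
    {ω : InfVolFermionState 2} (hω : ω.IsTranslationInvariant) (hρ : ω.density = 3 / 2)
    (hme : ω.meanEnergy (hubbardTTPrimeFermionInteraction 1 0 U) 1 = energyDensityTT' 1 0 U (3 / 2)) :
    Tendsto (fun M : ℕ =>
        (ω.expect (halfOpenBox 2 M) (etaRaise (fun w : PolySite (halfOpenBox 2 M) => siteStagger (ofLex w.1)) *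
          etaLower (fun w : PolySite (halfOpenBox 2 M) => siteStagger (ofLex w.1)))).re / (M : ℝ) ^ 4)
        atTop (𝓝 0) ∧
      ∀ {Λ Λ' : Finset (Site 2)}, Λ ⊆ Λ' → thicken Λ 1 ⊆ Λ' →
        (ω.expect Λ (etaRaise (fun w : PolySite Λ => siteStagger (ofLex w.1)) *
            etaLower (fun w : PolySite Λ => siteStagger (ofLex w.1)))).re ≤
          64 * ((#Λ' : ℝ) - #Λ) ^ 2 / (1.2251963 : ℝ) ^ 2 + 1 / 2 * #Λ := by
  obtain ⟨hω', hρ', hme'⟩ := groundStateClass_particleHole hU (n := 3 / 2) (by norm_num) (by norm_num) hω hρ hme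
  rw [show (2 : ℝ) - 3 / 2 = 1 / 2 by norm_num] at hρ' hme'
  have hA := etaPairing_exclusion_quarterFilling hU hω' hρ' hme'
  have hkey : ∀ Λ : Finset (Site 2),
      (ω.expect Λ (etaRaise (fun w : PolySite Λ => siteStagger (ofLex w.1)) *
          etaLower (fun w : PolySite Λ => siteStagger (ofLex w.1)))).re =
        (ω.particleHole.expect Λ (etaRaise (fun w : PolySite Λ => siteStagger (ofLex w.1)) *
          etaLower (fun w : PolySite Λ => siteStagger (ofLex w.1)))).re + 1 / 2 * #Λ := fun Λ => by
    have h := re_particleHole_expect_etaRaise_mul_etaLower hω' Λ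
    rw [InfVolFermionState.particleHole_particleHole, hρ'] at h
    rw [h]
    ring
  refine ⟨?_, fun {Λ Λ'} hΛ h8 => ?_⟩
  · have hsplit : (fun M : ℕ =>
        (ω.expect (halfOpenBox 2 M) (etaRaise (fun w : PolySite (halfOpenBox 2 M) => siteStagger (ofLex w.1)) *
          etaLower (fun w : PolySite (halfOpenBox 2 M) => siteStagger (ofLex w.1)))).re / (M : ℝ) ^ 4) =
        fun M : ℕ => (ω.particleHole.expect (halfOpenBox 2 M)
          (etaRaise (fun w : PolySite (halfOpenBox 2 M) => siteStagger (ofLex w.1)) *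
            etaLower (fun w : PolySite (halfOpenBox 2 M) => siteStagger (ofLex w.1)))).re / (M : ℝ) ^ 4 +
          1 / 2 * ((M : ℝ) ^ 2 / (M : ℝ) ^ 4) := by
      funext M
      rw [hkey, card_halfOpenBox]
      push_cast
      ring
    rw [hsplit, show (0 : ℝ) = 0 + 1 / 2 * 0 by ring]
    refine hA.1.add (Tendsto.const_mul _ ?_)
    have h2 : (fun M : ℕ => (M : ℝ) ^ 2 / (M : ℝ) ^ 4) =ᶠ[atTop] fun M : ℕ => ((M : ℝ) ^ 2)⁻¹ := by
      filter_upwards [eventually_gt_atTop 0] with M hM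
      have hM' : (0 : ℝ) < M := by exact_mod_cast hM
      field_simp
    rw [tendsto_congr' h2]
    exact tendsto_inv_atTop_zero.comp ((tendsto_pow_atTop two_ne_zero).comp tendsto_natCast_atTop_atTop)
  · rw [hkey]
    have hB := hA.2 hΛ h8
    linarith

end Summit.Ventures.CertifiedManyBodySolver.Observables

end
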